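import Mathlib
import Summits.NavierStokesRegularity.NavierStokesRegularity.Theorems.EulerZoomLiouvillePowerGaugeEulerLiouvilleHoopAxisFrame

/-!
# Hoop core — radial and axial derivatives along the cylinder chart, divergence in cylindrical components

Sub-problem `NavierStokesRegularity`, crux `PowerGaugeEulerLiouville` (a crux CLASS of self-similar Euler/NS strata — not NS
regularity).  Pointwise half of K-AXIS plate AX-2: at `y = axisPt s t θ` (`t > 0`),
* `∂_t axisPt = ê_r`, `∂_s axisPt = ê_z`, and the frame is constant along `t` and `s`;
* component laws `∂_t V_r = ⟪DV ê_r, ê_r⟫`, `∂_t V_θ = ⟪DV ê_r, ê_θ⟫`, `∂_t V_z = ⟪DV ê_r, ê_z⟫`, `∂_s V_r = ⟪DV ê_z, ê_r⟫`,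
  `∂_s V_θ = ⟪DV ê_z, ê_θ⟫`, `∂_s V_z = ⟪DV ê_z, ê_z⟫`;
* **divergence in cylindrical components**: `div V(y) = ∂_t V_r + (∂_θ V_θ + V_r)/t + ∂_s V_z`.
Together with `…HoopFrame` (θ-laws) and `…HoopAxisFrame` (AX-1) this is the frame dictionary the circle-averaged radial law uses.
-/

noncomputable section

set_option linter.dupNamespace false

open Set Function WithLp Metric Filter Topology
open scoped InnerProductSpace RealInnerProductSpace

namespace Summit.NavierStokesRegularity.NavierStokesRegularity.Theorems.PowerGaugeEulerLiouville.HoopCore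

open Literature.Analysis Literature.Analysis.FluidPDE

/-! ### The chart derivatives in `t` and `s` (local copies; public versions: `…HoopCircleAvgCalculus`) -/

/-- `∂_t axisPt s t θ = ê_r` (`t > 0`). [folklore] -/
private theorem hasDerivAt_axisPt_radius_loc (s : ℝ) {t : ℝ} (ht : 0 < t) (θ : ℝ) :
    HasDerivAt (fun t => axisPt s t θ) (eR (axisPt s t θ)) t := by
  have h : HasDerivAt (fun t => (t * Real.cos θ) • EuclideanSpace.single (0 : Fin 3) (1 : ℝ) +
      (t * Real.sin θ) • EuclideanSpace.single (1 : Fin 3) (1 : ℝ) + s • EuclideanSpace.single (2 : Fin 3) (1 : ℝ))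
      ((1 * Real.cos θ) • EuclideanSpace.single (0 : Fin 3) (1 : ℝ) +
        (1 * Real.sin θ) • EuclideanSpace.single (1 : Fin 3) (1 : ℝ) + 0) t :=
    ((((hasDerivAt_id t).mul_const _).smul_const _).add
      (((hasDerivAt_id t).mul_const _).smul_const _)).add (hasDerivAt_const t _)
  have e1 : (fun t => axisPt s t θ) = fun t => (t * Real.cos θ) • EuclideanSpace.single (0 : Fin 3) (1 : ℝ) +
      (t * Real.sin θ) • EuclideanSpace.single (1 : Fin 3) (1 : ℝ) + s • EuclideanSpace.single (2 : Fin 3) (1 : ℝ) := by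
    funext t; exact axisPt_eq s t θ
  have e2 : eR (axisPt s t θ) = (1 * Real.cos θ) • EuclideanSpace.single (0 : Fin 3) (1 : ℝ) +
      (1 * Real.sin θ) • EuclideanSpace.single (1 : Fin 3) (1 : ℝ) + 0 := by
    rw [eR_axisPt s ht θ]
    ext i
    fin_cases i <;> simp [rotZ]
  rw [e1, e2]
  exact h

/-- `∂_s axisPt s t θ = ê_z`. [folklore] -/
private theorem hasDerivAt_axisPt_height_loc (s t θ : ℝ) : HasDerivAt (fun s => axisPt s t θ) eZ s := by
  have h : HasDerivAt (fun s => (t * Real.cos θ) • EuclideanSpace.single (0 : Fin 3) (1 : ℝ) +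
      (t * Real.sin θ) • EuclideanSpace.single (1 : Fin 3) (1 : ℝ) + s • EuclideanSpace.single (2 : Fin 3) (1 : ℝ))
      (0 + (1 : ℝ) • EuclideanSpace.single (2 : Fin 3) (1 : ℝ)) s :=
    (hasDerivAt_const s _).add ((hasDerivAt_id s).smul_const _)
  have e1 : (fun s => axisPt s t θ) = fun s => (t * Real.cos θ) • EuclideanSpace.single (0 : Fin 3) (1 : ℝ) +
      (t * Real.sin θ) • EuclideanSpace.single (1 : Fin 3) (1 : ℝ) + s • EuclideanSpace.single (2 : Fin 3) (1 : ℝ) := by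
    funext s; exact axisPt_eq s t θ
  rw [e1, show eZ = 0 + (1 : ℝ) • EuclideanSpace.single (2 : Fin 3) (1 : ℝ) by rw [zero_add, one_smul]; rfl]
  exact h

/-- Chain rule in `t`: `∂_t V(axisPt s t θ) = DV(y) ê_r`. [folklore] -/
private theorem hasDerivAt_comp_axisPt_radius_loc {V : EuclideanSpace ℝ (Fin 3) → EuclideanSpace ℝ (Fin 3)} (s : ℝ) {t : ℝ}
    (ht : 0 < t) (θ : ℝ) (hV : DifferentiableAt ℝ V (axisPt s t θ)) :
    HasDerivAt (fun t => V (axisPt s t θ)) (fderiv ℝ V (axisPt s t θ) (eR (axisPt s t θ))) t :=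
  hV.hasFDerivAt.comp_hasDerivAt t (hasDerivAt_axisPt_radius_loc s ht θ)

/-- Chain rule in `s`: `∂_s V(axisPt s t θ) = DV(y) ê_z`. [folklore] -/
private theorem hasDerivAt_comp_axisPt_height_loc {V : EuclideanSpace ℝ (Fin 3) → EuclideanSpace ℝ (Fin 3)} (s t θ : ℝ)
    (hV : DifferentiableAt ℝ V (axisPt s t θ)) :
    HasDerivAt (fun s => V (axisPt s t θ)) (fderiv ℝ V (axisPt s t θ) eZ) s :=
  hV.hasFDerivAt.comp_hasDerivAt s (hasDerivAt_axisPt_height_loc s t θ)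

/-- The frame does not turn along `t`: `∂_t ê_r(axisPt s t θ) = 0` (`t > 0`). [folklore] -/
theorem hasDerivAt_eR_axisPt_radius (s : ℝ) {t : ℝ} (ht : 0 < t) (θ : ℝ) :
    HasDerivAt (fun t => eR (axisPt s t θ)) 0 t := by
  refine (hasDerivAt_const t (rotZ θ (EuclideanSpace.single (0 : Fin 3) (1 : ℝ)))).congr_of_eventuallyEq ?_
  filter_upwards [lt_mem_nhds ht] with t' ht'
  exact eR_axisPt s ht' θ

/-- The frame does not turn along `t`: `∂_t ê_θ(axisPt s t θ) = 0` (`t > 0`). [folklore] -/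
theorem hasDerivAt_eTheta_axisPt_radius (s : ℝ) {t : ℝ} (ht : 0 < t) (θ : ℝ) :
    HasDerivAt (fun t => eTheta (axisPt s t θ)) 0 t := by
  refine (hasDerivAt_const t (rotZ θ (EuclideanSpace.single (1 : Fin 3) (1 : ℝ)))).congr_of_eventuallyEq ?_
  filter_upwards [lt_mem_nhds ht] with t' ht'
  exact eTheta_axisPt s ht' θ

/-- The frame does not turn along `s`: `ê_r(axisPt s t θ)` is independent of `s` (`t > 0`). [folklore] -/
theorem eR_axisPt_height (s s' : ℝ) {t : ℝ} (ht : 0 < t) (θ : ℝ) : eR (axisPt s t θ) = eR (axisPt s' t θ) := by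
  rw [eR_axisPt s ht, eR_axisPt s' ht]

/-- `ê_θ(axisPt s t θ)` is independent of `s` (`t > 0`). [folklore] -/
theorem eTheta_axisPt_height (s s' : ℝ) {t : ℝ} (ht : 0 < t) (θ : ℝ) :
    eTheta (axisPt s t θ) = eTheta (axisPt s' t θ) := by
  rw [eTheta_axisPt s ht, eTheta_axisPt s' ht]

/-! ### Component laws in `t` and `s` -/

/-- **`∂_t V_r = ⟪DV ê_r, ê_r⟫`** along `t ↦ axisPt s t θ` (`t > 0`, `y = axisPt s t θ`). [folklore] -/
theorem hasDerivAt_radialVelocity_axisPt_radius {V : EuclideanSpace ℝ (Fin 3) → EuclideanSpace ℝ (Fin 3)} (s : ℝ)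
    {t : ℝ} (ht : 0 < t) (θ : ℝ) (hV : DifferentiableAt ℝ V (axisPt s t θ)) :
    HasDerivAt (fun t => radialVelocity V (axisPt s t θ))
      ⟪fderiv ℝ V (axisPt s t θ) (eR (axisPt s t θ)), eR (axisPt s t θ)⟫ t := by
  have h := (hasDerivAt_comp_axisPt_radius_loc s ht θ hV).inner ℝ (hasDerivAt_eR_axisPt_radius s ht θ)
  show HasDerivAt (fun t => ⟪V (axisPt s t θ), eR (axisPt s t θ)⟫) _ t
  refine h.congr_deriv ?_
  rw [inner_zero_right, zero_add]

/-- **`∂_t V_θ = ⟪DV ê_r, ê_θ⟫`** along `t ↦ axisPt s t θ` (`t > 0`). [folklore] -/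
theorem hasDerivAt_swirlVelocity_axisPt_radius {V : EuclideanSpace ℝ (Fin 3) → EuclideanSpace ℝ (Fin 3)} (s : ℝ)
    {t : ℝ} (ht : 0 < t) (θ : ℝ) (hV : DifferentiableAt ℝ V (axisPt s t θ)) :
    HasDerivAt (fun t => swirlVelocity V (axisPt s t θ))
      ⟪fderiv ℝ V (axisPt s t θ) (eR (axisPt s t θ)), eTheta (axisPt s t θ)⟫ t := by
  have h := (hasDerivAt_comp_axisPt_radius_loc s ht θ hV).inner ℝ (hasDerivAt_eTheta_axisPt_radius s ht θ)
  show HasDerivAt (fun t => ⟪V (axisPt s t θ), eTheta (axisPt s t θ)⟫) _ t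
  refine h.congr_deriv ?_
  rw [inner_zero_right, zero_add]

/-- **`∂_t V_z = ⟪DV ê_r, ê_z⟫`** along `t ↦ axisPt s t θ` (`t > 0`). [folklore] -/
theorem hasDerivAt_axialVelocity_axisPt_radius {V : EuclideanSpace ℝ (Fin 3) → EuclideanSpace ℝ (Fin 3)} (s : ℝ)
    {t : ℝ} (ht : 0 < t) (θ : ℝ) (hV : DifferentiableAt ℝ V (axisPt s t θ)) :
    HasDerivAt (fun t => axialVelocity V (axisPt s t θ))
      ⟪fderiv ℝ V (axisPt s t θ) (eR (axisPt s t θ)), eZ⟫ t := by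
  have h := (hasDerivAt_comp_axisPt_radius_loc s ht θ hV).inner ℝ (hasDerivAt_const t eZ)
  simp only [inner_zero_right, zero_add] at h
  have e : (fun t => axialVelocity V (axisPt s t θ)) = fun t => ⟪V (axisPt s t θ), eZ⟫ := by
    funext t; simp [axialVelocity, eZ, EuclideanSpace.inner_single_right]
  rw [e]
  exact h

/-- **`∂_s V_r = ⟪DV ê_z, ê_r⟫`** along `s ↦ axisPt s t θ` (`t > 0`). [folklore] -/
theorem hasDerivAt_radialVelocity_axisPt_height {V : EuclideanSpace ℝ (Fin 3) → EuclideanSpace ℝ (Fin 3)} (s : ℝ)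
    {t : ℝ} (ht : 0 < t) (θ : ℝ) (hV : DifferentiableAt ℝ V (axisPt s t θ)) :
    HasDerivAt (fun s => radialVelocity V (axisPt s t θ))
      ⟪fderiv ℝ V (axisPt s t θ) eZ, eR (axisPt s t θ)⟫ s := by
  have hc : HasDerivAt (fun s' => eR (axisPt s' t θ)) 0 s := by
    refine (hasDerivAt_const s (eR (axisPt s t θ))).congr_of_eventuallyEq (Eventually.of_forall fun s' => ?_)
    exact eR_axisPt_height s' s ht θ
  have h := (hasDerivAt_comp_axisPt_height_loc s t θ hV).inner ℝ hc
  show HasDerivAt (fun s => ⟪V (axisPt s t θ), eR (axisPt s t θ)⟫) _ s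
  refine h.congr_deriv ?_
  rw [inner_zero_right, zero_add]

/-- **`∂_s V_θ = ⟪DV ê_z, ê_θ⟫`** along `s ↦ axisPt s t θ` (`t > 0`). [folklore] -/
theorem hasDerivAt_swirlVelocity_axisPt_height {V : EuclideanSpace ℝ (Fin 3) → EuclideanSpace ℝ (Fin 3)} (s : ℝ)
    {t : ℝ} (ht : 0 < t) (θ : ℝ) (hV : DifferentiableAt ℝ V (axisPt s t θ)) :
    HasDerivAt (fun s => swirlVelocity V (axisPt s t θ))
      ⟪fderiv ℝ V (axisPt s t θ) eZ, eTheta (axisPt s t θ)⟫ s := by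
  have hc : HasDerivAt (fun s' => eTheta (axisPt s' t θ)) 0 s := by
    refine (hasDerivAt_const s (eTheta (axisPt s t θ))).congr_of_eventuallyEq (Eventually.of_forall fun s' => ?_)
    exact eTheta_axisPt_height s' s ht θ
  have h := (hasDerivAt_comp_axisPt_height_loc s t θ hV).inner ℝ hc
  show HasDerivAt (fun s => ⟪V (axisPt s t θ), eTheta (axisPt s t θ)⟫) _ s
  refine h.congr_deriv ?_
  rw [inner_zero_right, zero_add]

/-- **`∂_s V_z = ⟪DV ê_z, ê_z⟫`** along `s ↦ axisPt s t θ`. [folklore] -/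
theorem hasDerivAt_axialVelocity_axisPt_height {V : EuclideanSpace ℝ (Fin 3) → EuclideanSpace ℝ (Fin 3)} (s t θ : ℝ)
    (hV : DifferentiableAt ℝ V (axisPt s t θ)) :
    HasDerivAt (fun s => axialVelocity V (axisPt s t θ)) ⟪fderiv ℝ V (axisPt s t θ) eZ, eZ⟫ s := by
  have h := (hasDerivAt_comp_axisPt_height_loc s t θ hV).inner ℝ (hasDerivAt_const s eZ)
  simp only [inner_zero_right, zero_add] at h
  have e : (fun s => axialVelocity V (axisPt s t θ)) = fun s => ⟪V (axisPt s t θ), eZ⟫ := by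
    funext s; simp [axialVelocity, eZ, EuclideanSpace.inner_single_right]
  rw [e]
  exact h

/-! ### Divergence in cylindrical components -/

/-- The trace in the polar frame: `div V(y) = ⟪DV ê_r, ê_r⟫ + ⟪DV ê_θ, ê_θ⟫ + ⟪DV ê_z, ê_z⟫` at `y = axisPt s t θ`, `t > 0`.
[folklore] -/
theorem divergence_eq_polarFrame (V : EuclideanSpace ℝ (Fin 3) → EuclideanSpace ℝ (Fin 3)) (s : ℝ) {t : ℝ}
    (ht : 0 < t) (θ : ℝ) :
    VectorCalculus.divergence V (axisPt s t θ) =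
      ⟪fderiv ℝ V (axisPt s t θ) (eR (axisPt s t θ)), eR (axisPt s t θ)⟫ +
        ⟪fderiv ℝ V (axisPt s t θ) (eTheta (axisPt s t θ)), eTheta (axisPt s t θ)⟫ +
        ⟪fderiv ℝ V (axisPt s t θ) eZ, eZ⟫ := by
  have hc : ∀ b : EuclideanSpace ℝ (Fin 3),
      ⟪b, fderiv ℝ V (axisPt s t θ) b⟫ = ⟪fderiv ℝ V (axisPt s t θ) b, b⟫ := fun b => real_inner_comm _ _
  rw [divergence_eq_sum_inner_fderiv ((EuclideanSpace.basisFun (Fin 3) ℝ).map (rotZLIE θ)) V, Fin.sum_univ_three]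
  simp only [OrthonormalBasis.map_apply, EuclideanSpace.basisFun_apply, rotZLIE_apply, hc]
  rw [eR_axisPt s ht, eTheta_axisPt s ht, eZ_eq_rotZ θ]

/-- **DIVERGENCE IN CYLINDRICAL COMPONENTS**: at `y = axisPt s t θ` (`t > 0`, `V` differentiable at `y`),
`div V(y) = ∂_t V_r + (∂_θ V_θ + V_r)/t + ∂_s V_z`, the derivatives taken along the chart lines `t ↦ axisPt s t θ`,
`θ ↦ axisPt s t θ`, `s ↦ axisPt s t θ`. [folklore] -/
theorem divergence_eq_cyl {V : EuclideanSpace ℝ (Fin 3) → EuclideanSpace ℝ (Fin 3)} (s : ℝ) {t : ℝ} (ht : 0 < t)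
    (θ : ℝ) (hV : DifferentiableAt ℝ V (axisPt s t θ)) :
    VectorCalculus.divergence V (axisPt s t θ) =
      deriv (fun t => radialVelocity V (axisPt s t θ)) t +
        (deriv (fun θ => swirlVelocity V (axisPt s t θ)) θ + radialVelocity V (axisPt s t θ)) / t +
        deriv (fun s => axialVelocity V (axisPt s t θ)) s := by
  rw [divergence_eq_polarFrame V s ht θ, (hasDerivAt_radialVelocity_axisPt_radius s ht θ hV).deriv,
    (hasDerivAt_axialVelocity_axisPt_height s t θ hV).deriv, (fderiv_eTheta_components s ht θ hV).2.1]

/-- The directional derivative of a scalar component along the transport field, in the chart: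
for `V` differentiable at `y = axisPt s t θ` (`t > 0`) and any `w`,
`D(V_r)(y)[w] = ⟪w, ê_r⟫ ∂_t V_r + (⟪w, ê_θ⟫/t) ∂_θ V_r + ⟪w, ê_z⟫ ∂_s V_r` (frame expansion of `w` + the chart laws).
[folklore] -/
theorem fderiv_radialVelocity_eq_cyl {V : EuclideanSpace ℝ (Fin 3) → EuclideanSpace ℝ (Fin 3)} (s : ℝ) {t : ℝ}
    (ht : 0 < t) (θ : ℝ) (hV : DifferentiableAt ℝ V (axisPt s t θ)) (w : EuclideanSpace ℝ (Fin 3)) :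
    fderiv ℝ (radialVelocity V) (axisPt s t θ) w =
      ⟪w, eR (axisPt s t θ)⟫ * deriv (fun t => radialVelocity V (axisPt s t θ)) t +
        ⟪w, eTheta (axisPt s t θ)⟫ / t * deriv (fun θ => radialVelocity V (axisPt s t θ)) θ +
        ⟪w, eZ⟫ * deriv (fun s => radialVelocity V (axisPt s t θ)) s := by
  have hy : cylRadius (axisPt s t θ) ≠ 0 := by rw [cylRadius_axisPt s ht.le θ]; exact ht.ne'
  have hr : cylRadius (axisPt s t θ) = t := cylRadius_axisPt s ht.le θ
  -- expand `w` in the frame and use linearity of `DV(y)`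
  have hw : w = ⟪w, eR (axisPt s t θ)⟫ • eR (axisPt s t θ) + ⟪w, eTheta (axisPt s t θ)⟫ • eTheta (axisPt s t θ) +
      ⟪w, eZ⟫ • eZ := by
    have h1 : w = toLp 2 ![w 0, w 1, 0] + (w 2) • eZ := by
      ext i; fin_cases i <;> simp [eZ]
    have h2 : ⟪w, eZ⟫ = w 2 := by simp [eZ, EuclideanSpace.inner_single_right]
    rw [h2]
    conv_lhs => rw [h1, horizontal_eq_frame hy w]
  have key : ∀ v : EuclideanSpace ℝ (Fin 3), fderiv ℝ (radialVelocity V) (axisPt s t θ) v =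
      ⟪fderiv ℝ V (axisPt s t θ) v, eR (axisPt s t θ)⟫ +
        swirlVelocity V (axisPt s t θ) * ⟪v, eTheta (axisPt s t θ)⟫ / cylRadius (axisPt s t θ) := by
    intro v; rw [inner_fderiv_eR_eq hy hV v]; ring
  rw [key, (hasDerivAt_radialVelocity_axisPt_radius s ht θ hV).deriv, (hasDerivAt_radialVelocity_axisPt s ht θ hV).deriv,
    (hasDerivAt_radialVelocity_axisPt_height s ht θ hV).deriv, hr]
  conv_lhs => rw [hw]
  have hRT : ⟪eR (axisPt s t θ), eTheta (axisPt s t θ)⟫ = 0 := by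
    rw [eR_axisPt s ht, eTheta_axisPt s ht, ← rotZLIE_apply, ← rotZLIE_apply, LinearIsometryEquiv.inner_map_map]
    simp [EuclideanSpace.inner_single_left]
  have hTT : ⟪eTheta (axisPt s t θ), eTheta (axisPt s t θ)⟫ = 1 := by
    rw [eTheta_axisPt s ht, real_inner_self_eq_norm_sq, ← rotZLIE_apply, LinearIsometryEquiv.norm_map]; simp
  have hZT : ⟪eZ, eTheta (axisPt s t θ)⟫ = 0 := by
    rw [eZ_eq_rotZ θ, eTheta_axisPt s ht, ← rotZLIE_apply, ← rotZLIE_apply, LinearIsometryEquiv.inner_map_map]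
    simp [EuclideanSpace.inner_single_left]
  simp only [map_add, map_smul, inner_add_left, inner_smul_left, RCLike.conj_to_real, hRT, hTT, hZT]
  field_simp
  ring

end Summit.NavierStokesRegularity.NavierStokesRegularity.Theorems.PowerGaugeEulerLiouville.HoopCore

end
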